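import Summits.PneNP.PneNP.Theorems.KarlinRubinMonotoneBlindDepth3Planted

/-!
# Route KarlinRubin, crux `MonotoneBlind` (stmt-PneNP-18027): DEPTH-3 BLINDNESS

**Theorem (`karlinRubin_monotoneBlind_depth3`).** For `0 < δ < 1/2` and every `c`: no family `f_n = ⋁_{i < m n} g_{n,i}`
of ORs of `m n ≤ n^c` monotone CNFs `g_{n,i}` (clause families `𝓒 n i` with `≤ n^c` clauses of ANY width) on the edge
slots of `Kₙ` has `Pr_{G(n,1/2)}[f_n] + Pr_{G(n,1/2,⌈n^{1/2-δ}⌉)}[¬ f_n] → 0`. Equivalently: quiet polynomial-size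
monotone depth-3 (OR ∘ AND ∘ OR) circuits are blind to the planted clique below `√n`
(`karlinRubin_depth3_planted_tendsto_zero`: quiet ⇒ planted acceptance `→ 0`), and no circuit family over any basis
computing such functions strongly detects (`karlinRubin_not_detects_of_computes_depth3`). This is the first level at
which gates are SHARED between the accepted witnesses (the AND of poly many ORs); depth 2 is `karlinRubin_monotoneBlind_dnf`
/ `karlinRubin_monotoneBlind_cnf`. Seat write-up `MonotoneBlind_depth3_theorem.md` (witness lemma with constant budget,
rescue lemma via resampling + encoding of minimal touching sets).

This file discharges the numeric hypotheses `H1`–`H6` of `depth3_planted_le` eventually, for `k = ⌈n^{1/2-δ}⌉`,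
`L' = (2c+2)(⌊log₂ n⌋+1)`, `v₀ = ⌊(4c+4)/(1+2δ)⌋+1`, `M = ⌊(c+1)/δ⌋+1` (`eventually_depth3_H*`, from
`(log n)^a n^α ≤ n^β` eventually for `α < β`), and concludes.

All `--supports stmt-PneNP-18027`; no definitions.
-/

set_option linter.dupNamespace false -- `Summit.PneNP.PneNP.…`: summit = sub-problem (D-0017)

namespace Summit.PneNP.PneNP.Theorems

open Finset Filter Topology Asymptotics
open scoped ENNReal
open Literature.Computability.Complexity
open Literature.Probability.RandomGraphs.PlantedClique

/-! ### One asymptotic fact: `C (log n)^a n^α ≤ n^β` eventually for `α < β` -/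

/-- **Polylog times a smaller power is eventually below a larger power.** [folklore] -/
theorem eventually_const_mul_log_pow_mul_rpow_le (C : ℝ) (a : ℕ) {α β : ℝ} (hαβ : α < β) :
    ∀ᶠ n : ℕ in atTop, C * Real.log n ^ a * (n : ℝ) ^ α ≤ (n : ℝ) ^ β := by
  rcases le_or_gt C 0 with hC | hC
  · filter_upwards [eventually_ge_atTop 1] with n hn
    have h1 : C * Real.log n ^ a * (n : ℝ) ^ α ≤ 0 := by
      have : 0 ≤ Real.log n ^ a * (n : ℝ) ^ α :=
        mul_nonneg (pow_nonneg (Real.log_nonneg (by exact_mod_cast hn)) a) (by positivity)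
      nlinarith
    exact h1.trans (by positivity)
  set γ := (β - α) / 2 with hγ
  have hγpos : 0 < γ := by rw [hγ]; linarith
  -- `(log n)^a ≤ n^γ` eventually
  have hlog : ∀ᶠ n : ℕ in atTop, Real.log n ^ a ≤ (n : ℝ) ^ γ := by
    rcases Nat.eq_zero_or_pos a with ha | ha
    · filter_upwards [eventually_ge_atTop 1] with n hn
      rw [ha, pow_zero]
      exact Real.one_le_rpow (by exact_mod_cast hn) hγpos.le
    · have hr : 0 < γ / a := div_pos hγpos (by exact_mod_cast ha)
      have hlo : (fun x : ℝ => Real.log x ^ a) =o[atTop] fun x : ℝ => (x ^ (γ / a)) ^ a :=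
        (isLittleO_log_rpow_atTop hr).pow ha
      have hev := (hlo.comp_tendsto tendsto_natCast_atTop_atTop).def zero_lt_one
      filter_upwards [hev, eventually_ge_atTop 1] with n h hn1
      have hnR : (0 : ℝ) ≤ n := Nat.cast_nonneg n
      simp only [Function.comp, Real.norm_eq_abs, one_mul] at h
      rw [abs_of_nonneg (pow_nonneg (Real.log_nonneg (by exact_mod_cast hn1)) a),
        abs_of_nonneg (by positivity)] at h
      have hpow : ((n : ℝ) ^ (γ / a)) ^ a = (n : ℝ) ^ γ := by
        rw [← Real.rpow_natCast, ← Real.rpow_mul hnR]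
        congr 1
        field_simp
      rwa [hpow] at h
  -- `C ≤ n^γ` eventually
  have hconst : ∀ᶠ n : ℕ in atTop, C ≤ (n : ℝ) ^ γ :=
    ((tendsto_rpow_atTop hγpos).comp tendsto_natCast_atTop_atTop).eventually_ge_atTop C
  filter_upwards [hlog, hconst, eventually_ge_atTop 1] with n h1 h2 hn1
  have hnR : (0 : ℝ) < n := by exact_mod_cast hn1
  have hsplit : (n : ℝ) ^ γ * (n : ℝ) ^ γ * (n : ℝ) ^ α = (n : ℝ) ^ β := by
    rw [← Real.rpow_add hnR, ← Real.rpow_add hnR]; congr 1; rw [hγ]; ring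
  have hlog0 : 0 ≤ Real.log n ^ a := pow_nonneg (Real.log_nonneg (by exact_mod_cast hn1)) a
  calc C * Real.log n ^ a * (n : ℝ) ^ α ≤ (n : ℝ) ^ γ * (n : ℝ) ^ γ * (n : ℝ) ^ α := by gcongr
    _ = (n : ℝ) ^ β := hsplit

/-! ### The parameters and their real bounds -/

/-- `min(⌈n^{1/2-δ}⌉, n) ≤ 2 n^{1/2-δ}` for `n ≥ 1`. [folklore] -/
theorem min_ceil_rpow_le {δ : ℝ} (hδ' : δ < 1 / 2) {n : ℕ} (hn : 1 ≤ n) :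
    ((min ⌈(n : ℝ) ^ (1 / 2 - δ)⌉₊ n : ℕ) : ℝ) ≤ 2 * (n : ℝ) ^ (1 / 2 - δ) := by
  have h := ceil_rpow_le_two_mul hδ' hn
  have hmin : ((min ⌈(n : ℝ) ^ (1 / 2 - δ)⌉₊ n : ℕ) : ℝ) ≤ (⌈(n : ℝ) ^ (1 / 2 - δ)⌉₊ : ℝ) := by
    exact_mod_cast min_le_left _ _
  exact hmin.trans h

/-- `(2c+2)(⌊log₂ n⌋ + 1) ≤ (6c+6) log n` for `n ≥ 3`. [folklore] -/
theorem cutoff_le_mul_log (c : ℕ) {n : ℕ} (hn : 3 ≤ n) :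
    (((2 * c + 2) * (Nat.log 2 n + 1) : ℕ) : ℝ) ≤ (6 * c + 6) * Real.log n := by
  have hn1 : 1 ≤ n := by omega
  have hL : (Nat.log 2 n : ℝ) ≤ 2 * Real.log n := natLog_two_le_two_mul_log hn1
  have hlog1 : 1 ≤ Real.log n := by
    rw [← Real.log_exp 1]
    refine Real.log_le_log (Real.exp_pos 1) ?_
    have h3 : (3 : ℝ) ≤ n := by exact_mod_cast hn
    linarith [Real.exp_one_lt_d9]
  have hc : (0 : ℝ) ≤ c := Nat.cast_nonneg c
  push_cast
  nlinarith

/-- **H1 always**: `n^{2c+2} ≤ 2^{(2c+2)(⌊log₂ n⌋+1)}`. [folklore] -/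
theorem depth3_H1 (n c : ℕ) : n ^ (2 * c + 2) ≤ 2 ^ ((2 * c + 2) * (Nat.log 2 n + 1)) := by
  calc n ^ (2 * c + 2) ≤ (2 ^ (Nat.log 2 n + 1)) ^ (2 * c + 2) :=
        Nat.pow_le_pow_left (Nat.lt_pow_succ_log_self one_lt_two n).le _
    _ = 2 ^ ((2 * c + 2) * (Nat.log 2 n + 1)) := by rw [← pow_mul, mul_comm]

/-- **H2 eventually**: `M² ≤ 2 (2c+2)(⌊log₂ n⌋+1)`. [folklore] -/
theorem eventually_depth3_H2 (c M : ℕ) : ∀ᶠ n : ℕ in atTop, M * M ≤ 2 * ((2 * c + 2) * (Nat.log 2 n + 1)) := by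
  filter_upwards [eventually_ge_atTop (2 ^ (M * M))] with n hn
  have hlog : M * M ≤ Nat.log 2 n := Nat.le_log_of_pow_le one_lt_two hn
  nlinarith

/-- **H3 eventually**: `18 d² ≤ n` for `d = min(⌈n^{1/2-δ}⌉, n)`. [folklore] -/
theorem eventually_depth3_H3 {δ : ℝ} (hδ : 0 < δ) (hδ' : δ < 1 / 2) :
    ∀ᶠ n : ℕ in atTop, 18 * (min ⌈(n : ℝ) ^ (1 / 2 - δ)⌉₊ n * min ⌈(n : ℝ) ^ (1 / 2 - δ)⌉₊ n) ≤ n := by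
  have hev := eventually_const_mul_log_pow_mul_rpow_le 72 0 (show 1 - 2 * δ < (1 : ℝ) by linarith)
  filter_upwards [hev, eventually_ge_atTop 1] with n h hn1
  have hnR : (0 : ℝ) < n := by exact_mod_cast hn1
  have hd := min_ceil_rpow_le hδ' hn1
  set dd := min ⌈(n : ℝ) ^ (1 / 2 - δ)⌉₊ n with hdd
  have hsq : ((n : ℝ) ^ (1 / 2 - δ)) * ((n : ℝ) ^ (1 / 2 - δ)) = (n : ℝ) ^ (1 - 2 * δ) := by
    rw [← Real.rpow_add hnR]; ring_nf
  have hreal : ((18 * (dd * dd) : ℕ) : ℝ) ≤ n := by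
    push_cast
    calc (18 : ℝ) * ((dd : ℝ) * (dd : ℝ))
        ≤ 18 * ((2 * (n : ℝ) ^ (1 / 2 - δ)) * (2 * (n : ℝ) ^ (1 / 2 - δ))) := by gcongr
      _ = 72 * Real.log n ^ 0 * (n : ℝ) ^ (1 - 2 * δ) := by rw [pow_zero, ← hsq]; ring
      _ ≤ (n : ℝ) ^ (1 : ℝ) := h
      _ = n := Real.rpow_one _
  exact_mod_cast hreal

/-- **H6 eventually**: `2 (2 L' d) ≤ n` for `L' = (2c+2)(⌊log₂ n⌋+1)`, `d = min(⌈n^{1/2-δ}⌉, n)`. [folklore] -/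
theorem eventually_depth3_H6 {δ : ℝ} (hδ : 0 < δ) (hδ' : δ < 1 / 2) (c : ℕ) :
    ∀ᶠ n : ℕ in atTop, 2 * (2 * ((2 * c + 2) * (Nat.log 2 n + 1)) * min ⌈(n : ℝ) ^ (1 / 2 - δ)⌉₊ n) ≤ n := by
  have hev := eventually_const_mul_log_pow_mul_rpow_le (8 * (6 * c + 6)) 1
    (show 1 / 2 - δ < (1 : ℝ) by linarith)
  filter_upwards [hev, eventually_ge_atTop 3] with n h hn3
  have hn1 : 1 ≤ n := by omega
  have hd := min_ceil_rpow_le hδ' hn1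
  have hL := cutoff_le_mul_log c hn3
  set dd := min ⌈(n : ℝ) ^ (1 / 2 - δ)⌉₊ n with hdd
  set LL := (2 * c + 2) * (Nat.log 2 n + 1) with hLL
  have hlog0 : 0 ≤ Real.log n := Real.log_nonneg (by exact_mod_cast hn1)
  have hreal : ((2 * (2 * LL * dd) : ℕ) : ℝ) ≤ n := by
    have hc0 : (0 : ℝ) ≤ 6 * c + 6 := by positivity
    push_cast
    calc (2 * (2 * (LL : ℝ) * (dd : ℝ)) : ℝ) = 4 * (LL : ℝ) * (dd : ℝ) := by ring
      _ ≤ 4 * ((6 * c + 6) * Real.log n) * (2 * (n : ℝ) ^ (1 / 2 - δ)) := by gcongr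
      _ = 8 * (6 * c + 6) * Real.log n ^ 1 * (n : ℝ) ^ (1 / 2 - δ) := by ring
      _ ≤ (n : ℝ) ^ (1 : ℝ) := h
      _ = n := Real.rpow_one _
  exact_mod_cast hreal

/-- **H5 eventually**: `(4 L' d)^{v₀} n^{2c+2} ≤ n^{v₀}` for `v₀ = ⌊(4c+4)/(1+2δ)⌋ + 1` (so that
`v₀ (1/2+δ) > 2c+2`). [folklore] -/
theorem eventually_depth3_H5 {δ : ℝ} (hδ : 0 < δ) (hδ' : δ < 1 / 2) (c : ℕ) :
    ∀ᶠ n : ℕ in atTop, (4 * ((2 * c + 2) * (Nat.log 2 n + 1)) * min ⌈(n : ℝ) ^ (1 / 2 - δ)⌉₊ n) ^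
        (⌊(4 * c + 4 : ℝ) / (1 + 2 * δ)⌋₊ + 1) * n ^ (2 * c + 2) ≤ n ^ (⌊(4 * c + 4 : ℝ) / (1 + 2 * δ)⌋₊ + 1) := by
  set v₀ := ⌊(4 * c + 4 : ℝ) / (1 + 2 * δ)⌋₊ + 1 with hv₀
  -- the exponent gap
  have hgap : (v₀ : ℝ) * (1 / 2 - δ) + (2 * c + 2) < v₀ := by
    have hlt : (4 * c + 4 : ℝ) / (1 + 2 * δ) < v₀ := by rw [hv₀]; push_cast; exact Nat.lt_floor_add_one _
    have hpos : (0 : ℝ) < 1 + 2 * δ := by linarith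
    rw [div_lt_iff₀ hpos] at hlt
    nlinarith
  have hev := eventually_const_mul_log_pow_mul_rpow_le ((8 * (6 * c + 6)) ^ v₀) v₀ hgap
  filter_upwards [hev, eventually_ge_atTop 3] with n h hn3
  have hn1 : 1 ≤ n := by omega
  have hnR : (0 : ℝ) < n := by exact_mod_cast hn1
  have hd := min_ceil_rpow_le hδ' hn1
  have hL := cutoff_le_mul_log c hn3
  set dd := min ⌈(n : ℝ) ^ (1 / 2 - δ)⌉₊ n with hdd
  set LL := (2 * c + 2) * (Nat.log 2 n + 1) with hLL
  have hlog0 : 0 ≤ Real.log n := Real.log_nonneg (by exact_mod_cast hn1)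
  -- the base
  have hbase : ((4 * LL * dd : ℕ) : ℝ) ≤ 8 * (6 * c + 6) * Real.log n * (n : ℝ) ^ (1 / 2 - δ) := by
    have hc0 : (0 : ℝ) ≤ 6 * c + 6 := by positivity
    push_cast
    calc (4 * (LL : ℝ) * (dd : ℝ) : ℝ)
        ≤ 4 * ((6 * c + 6) * Real.log n) * (2 * (n : ℝ) ^ (1 / 2 - δ)) := by gcongr
      _ = 8 * (6 * c + 6) * Real.log n * (n : ℝ) ^ (1 / 2 - δ) := by ring
  have hbase0 : (0 : ℝ) ≤ ((4 * LL * dd : ℕ) : ℝ) := Nat.cast_nonneg _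
  have hreal : (((4 * LL * dd) ^ v₀ * n ^ (2 * c + 2) : ℕ) : ℝ) ≤ (n : ℝ) ^ v₀ := by
    have hpow : ((n : ℝ) ^ (1 / 2 - δ)) ^ v₀ * (n : ℝ) ^ (2 * c + 2) = (n : ℝ) ^ ((v₀ : ℝ) * (1 / 2 - δ) + (2 * c + 2)) := by
      rw [← Real.rpow_natCast, ← Real.rpow_mul hnR.le, ← Real.rpow_natCast, ← Real.rpow_add hnR]
      congr 1; push_cast; ring
    rw [Nat.cast_mul, Nat.cast_pow, Nat.cast_pow]
    calc (((4 * LL * dd : ℕ) : ℝ)) ^ v₀ * (n : ℝ) ^ (2 * c + 2)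
        ≤ (8 * (6 * c + 6) * Real.log n * (n : ℝ) ^ (1 / 2 - δ)) ^ v₀ * (n : ℝ) ^ (2 * c + 2) := by gcongr
      _ = (8 * (6 * c + 6)) ^ v₀ * Real.log n ^ v₀ * (((n : ℝ) ^ (1 / 2 - δ)) ^ v₀ * (n : ℝ) ^ (2 * c + 2)) := by
          rw [mul_pow, mul_pow]; ring
      _ = (8 * (6 * c + 6)) ^ v₀ * Real.log n ^ v₀ * (n : ℝ) ^ ((v₀ : ℝ) * (1 / 2 - δ) + (2 * c + 2)) := by rw [hpow]
      _ ≤ (n : ℝ) ^ (v₀ : ℝ) := h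
      _ = (n : ℝ) ^ v₀ := Real.rpow_natCast _ _
  exact_mod_cast hreal

/-- **H4 eventually**: `(18 d²)^M n^{2c+2} ≤ n^M` for `M = ⌊(c+1)/δ⌋ + 1` (so that `2δM > 2c+2`). [folklore] -/
theorem eventually_depth3_H4 {δ : ℝ} (hδ : 0 < δ) (hδ' : δ < 1 / 2) (c : ℕ) :
    ∀ᶠ n : ℕ in atTop, (18 * (min ⌈(n : ℝ) ^ (1 / 2 - δ)⌉₊ n * min ⌈(n : ℝ) ^ (1 / 2 - δ)⌉₊ n)) ^
        (⌊(c + 1 : ℝ) / δ⌋₊ + 1) * n ^ (2 * c + 2) ≤ n ^ (⌊(c + 1 : ℝ) / δ⌋₊ + 1) := by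
  set M := ⌊(c + 1 : ℝ) / δ⌋₊ + 1 with hM
  have hgap : (M : ℝ) * (1 - 2 * δ) + (2 * c + 2) < M := by
    have hlt : (c + 1 : ℝ) / δ < M := by rw [hM]; push_cast; exact Nat.lt_floor_add_one _
    rw [div_lt_iff₀ hδ] at hlt
    nlinarith
  have hev := eventually_const_mul_log_pow_mul_rpow_le ((72 : ℝ) ^ M) 0 hgap
  filter_upwards [hev, eventually_ge_atTop 1] with n h hn1
  have hnR : (0 : ℝ) < n := by exact_mod_cast hn1
  have hd := min_ceil_rpow_le hδ' hn1
  set dd := min ⌈(n : ℝ) ^ (1 / 2 - δ)⌉₊ n with hdd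
  have hsq : ((n : ℝ) ^ (1 / 2 - δ)) * ((n : ℝ) ^ (1 / 2 - δ)) = (n : ℝ) ^ (1 - 2 * δ) := by
    rw [← Real.rpow_add hnR]; ring_nf
  have hbase : ((18 * (dd * dd) : ℕ) : ℝ) ≤ 72 * (n : ℝ) ^ (1 - 2 * δ) := by
    push_cast
    calc (18 : ℝ) * ((dd : ℝ) * (dd : ℝ))
        ≤ 18 * ((2 * (n : ℝ) ^ (1 / 2 - δ)) * (2 * (n : ℝ) ^ (1 / 2 - δ))) := by gcongr
      _ = 72 * (n : ℝ) ^ (1 - 2 * δ) := by rw [← hsq]; ring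
  have hbase0 : (0 : ℝ) ≤ ((18 * (dd * dd) : ℕ) : ℝ) := Nat.cast_nonneg _
  have hreal : (((18 * (dd * dd)) ^ M * n ^ (2 * c + 2) : ℕ) : ℝ) ≤ (n : ℝ) ^ M := by
    have hpow : ((n : ℝ) ^ (1 - 2 * δ)) ^ M * (n : ℝ) ^ (2 * c + 2) = (n : ℝ) ^ ((M : ℝ) * (1 - 2 * δ) + (2 * c + 2)) := by
      rw [← Real.rpow_natCast, ← Real.rpow_mul hnR.le, ← Real.rpow_natCast, ← Real.rpow_add hnR]
      congr 1; push_cast; ring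
    rw [Nat.cast_mul, Nat.cast_pow, Nat.cast_pow]
    calc (((18 * (dd * dd) : ℕ) : ℝ)) ^ M * (n : ℝ) ^ (2 * c + 2)
        ≤ (72 * (n : ℝ) ^ (1 - 2 * δ)) ^ M * (n : ℝ) ^ (2 * c + 2) := by gcongr
      _ = 72 ^ M * Real.log n ^ 0 * (((n : ℝ) ^ (1 - 2 * δ)) ^ M * (n : ℝ) ^ (2 * c + 2)) := by
          rw [mul_pow, pow_zero]; ring
      _ = 72 ^ M * Real.log n ^ 0 * (n : ℝ) ^ ((M : ℝ) * (1 - 2 * δ) + (2 * c + 2)) := by rw [hpow]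
      _ ≤ (n : ℝ) ^ (M : ℝ) := h
      _ = (n : ℝ) ^ M := Real.rpow_natCast _ _
  exact_mod_cast hreal

/-! ### The theorem -/

/-- **Quiet polynomial ORs of polynomial monotone CNFs are blind to the planted clique.** For `0 < δ < 1/2` and
`c : ℕ`: if `m n ≤ n^c` and `#(𝓒 n i) ≤ n^c` eventually and the null acceptance
`Pr_{G(n,1/2)}[∃ i, ∀ S ∈ 𝓒 n i, ∃ e ∈ S, x e] → 0`, then the planted acceptance (clique size `⌈n^{1/2-δ}⌉`) tends to
`0` too: by `depth3_planted_le` it is `≤ 2^t · null + C₀ / n²` eventually, with `t, C₀` depending on `c, δ` only.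
[folklore] -/
theorem karlinRubin_depth3_planted_tendsto_zero {δ : ℝ} (hδ : 0 < δ) (hδ' : δ < 1 / 2) (c : ℕ) (m : ℕ → ℕ)
    (𝓒 : (n : ℕ) → Fin (m n) → Finset (Finset (⊤ : SimpleGraph (Fin n)).edgeSet))
    (hm : ∀ᶠ n : ℕ in atTop, m n ≤ n ^ c) (h𝓒 : ∀ᶠ n : ℕ in atTop, ∀ i, #(𝓒 n i) ≤ n ^ c)
    (hquiet : Tendsto (fun n : ℕ =>
      (erdosRenyiHalf n).toOuterMeasure {x | ∃ i, ∀ S ∈ 𝓒 n i, ∃ e ∈ S, x e = true}) atTop (𝓝 0)) :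
    Tendsto (fun n : ℕ => (plantedCliqueDist n ⌈(n : ℝ) ^ (1 / 2 - δ)⌉₊).toOuterMeasure
      {x | ∃ i, ∀ S ∈ 𝓒 n i, ∃ e ∈ S, x e = true}) atTop (𝓝 0) := by
  set v₀ := ⌊(4 * c + 4 : ℝ) / (1 + 2 * δ)⌋₊ + 1 with hv₀
  set M := ⌊(c + 1 : ℝ) / δ⌋₊ + 1 with hM
  set r := (v₀ - 1).choose 2 with hr
  set t := (r + 1) * r with ht
  set C₀ : ℝ≥0∞ := 2 ^ ((r + 1) * r + 1) + 3 with hC₀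
  -- the bound `2^t · null + C₀ (n²)⁻¹ → 0`
  have hinv : Tendsto (fun n : ℕ => (((n ^ 2 : ℕ) : ℝ≥0∞))⁻¹) atTop (𝓝 0) := by
    refine tendsto_of_tendsto_of_tendsto_of_le_of_le' tendsto_const_nhds ENNReal.tendsto_inv_nat_nhds_zero
      (Eventually.of_forall fun _ => bot_le) ?_
    filter_upwards [eventually_ge_atTop 1] with n hn
    apply ENNReal.inv_le_inv.2
    exact_mod_cast (Nat.le_self_pow two_ne_zero n)
  have hC₀top : C₀ ≠ ⊤ := by
    rw [hC₀]; exact ENNReal.add_ne_top.2 ⟨ENNReal.pow_ne_top ENNReal.ofNat_ne_top, ENNReal.ofNat_ne_top⟩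
  have hbound : Tendsto (fun n : ℕ => (2 : ℝ≥0∞) ^ t *
      (erdosRenyiHalf n).toOuterMeasure {x | ∃ i, ∀ S ∈ 𝓒 n i, ∃ e ∈ S, x e = true} +
        C₀ * (((n ^ 2 : ℕ) : ℝ≥0∞))⁻¹) atTop (𝓝 0) := by
    have h1 := ENNReal.Tendsto.const_mul hquiet (Or.inr (ENNReal.pow_ne_top ENNReal.ofNat_ne_top) :
      (0 : ℝ≥0∞) ≠ 0 ∨ (2 : ℝ≥0∞) ^ t ≠ ⊤)
    have h2 := ENNReal.Tendsto.const_mul hinv (Or.inr hC₀top : (0 : ℝ≥0∞) ≠ 0 ∨ C₀ ≠ ⊤)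
    simpa using h1.add h2
  refine tendsto_of_tendsto_of_tendsto_of_le_of_le' tendsto_const_nhds hbound
    (Eventually.of_forall fun _ => bot_le) ?_
  filter_upwards [hm, h𝓒, eventually_depth3_H2 c M, eventually_depth3_H3 hδ hδ', eventually_depth3_H4 hδ hδ' c,
    eventually_depth3_H5 hδ hδ' c, eventually_depth3_H6 hδ hδ' c, eventually_ge_atTop 1]
    with n hmn h𝓒n H2 H3 H4 H5 H6 hn1
  have hv₀1 : 1 ≤ v₀ := Nat.succ_le_succ (Nat.zero_le _)
  have hL' : 1 ≤ (2 * c + 2) * (Nat.log 2 n + 1) := Nat.one_le_iff_ne_zero.2 (by positivity)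
  have h := depth3_planted_le (L' := (2 * c + 2) * (Nat.log 2 n + 1)) (v₀ := v₀) (M := M) hn1
    ⌈(n : ℝ) ^ (1 / 2 - δ)⌉₊ (𝓒 n) hmn h𝓒n hv₀1 hL' (depth3_H1 n c) H2 H3 H4 H5 H6
  simpa only [← hr, ← ht, ← hC₀] using h

/-- **`MonotoneBlind` at depth 3 (OR ∘ AND ∘ OR, polynomial fan-ins, any clause widths).** For `0 < δ < 1/2` and
every `c`, NO family of ORs of `≤ n^c` monotone CNFs with `≤ n^c` clauses each has
`Pr_{G(n,1/2)}[accept] + Pr_{G(n,1/2,⌈n^{1/2-δ}⌉)}[reject] → 0`: the error sum forces the null acceptance to `0`, hence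
(previous theorem) the planted acceptance to `0`, i.e. the planted rejection to `1`. [folklore] -/
theorem karlinRubin_monotoneBlind_depth3 {δ : ℝ} (hδ : 0 < δ) (hδ' : δ < 1 / 2) (c : ℕ) (m : ℕ → ℕ)
    (𝓒 : (n : ℕ) → Fin (m n) → Finset (Finset (⊤ : SimpleGraph (Fin n)).edgeSet))
    (hm : ∀ᶠ n : ℕ in atTop, m n ≤ n ^ c) (h𝓒 : ∀ᶠ n : ℕ in atTop, ∀ i, #(𝓒 n i) ≤ n ^ c) :
    ¬ Tendsto (fun n : ℕ =>
        (erdosRenyiHalf n).toOuterMeasure {x | ∃ i, ∀ S ∈ 𝓒 n i, ∃ e ∈ S, x e = true} +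
          (plantedCliqueDist n ⌈(n : ℝ) ^ (1 / 2 - δ)⌉₊).toOuterMeasure
            {x | ¬ ∃ i, ∀ S ∈ 𝓒 n i, ∃ e ∈ S, x e = true}) atTop (𝓝 0) := by
  intro hT
  have hquiet : Tendsto (fun n : ℕ =>
      (erdosRenyiHalf n).toOuterMeasure {x | ∃ i, ∀ S ∈ 𝓒 n i, ∃ e ∈ S, x e = true}) atTop (𝓝 0) :=
    tendsto_of_tendsto_of_tendsto_of_le_of_le' tendsto_const_nhds hT (Eventually.of_forall fun _ => bot_le)
      (Eventually.of_forall fun _ => le_self_add)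
  have hP := karlinRubin_depth3_planted_tendsto_zero hδ hδ' c m 𝓒 hm h𝓒 hquiet
  have hhalf : (0 : ℝ≥0∞) < 1 / 2 := by simp
  obtain ⟨n, hn1, hn2⟩ := ((hT.eventually (gt_mem_nhds hhalf)).and (hP.eventually (gt_mem_nhds hhalf))).exists
  have hcompl : (plantedCliqueDist n ⌈(n : ℝ) ^ (1 / 2 - δ)⌉₊).toOuterMeasure
        {x | ∃ i, ∀ S ∈ 𝓒 n i, ∃ e ∈ S, x e = true} +
      (plantedCliqueDist n ⌈(n : ℝ) ^ (1 / 2 - δ)⌉₊).toOuterMeasure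
        {x | ¬ ∃ i, ∀ S ∈ 𝓒 n i, ∃ e ∈ S, x e = true} = 1 := by
    have h := (plantedCliqueDist n ⌈(n : ℝ) ^ (1 / 2 - δ)⌉₊).toOuterMeasure_add_compl
      {x | ∃ i, ∀ S ∈ 𝓒 n i, ∃ e ∈ S, x e = true}
    have hc : {x : EdgeVec n | ¬ ∃ i, ∀ S ∈ 𝓒 n i, ∃ e ∈ S, x e = true} =
        {x : EdgeVec n | ∃ i, ∀ S ∈ 𝓒 n i, ∃ e ∈ S, x e = true}ᶜ := by
      ext x; simp
    rw [hc]
    exact h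
  have hR : (plantedCliqueDist n ⌈(n : ℝ) ^ (1 / 2 - δ)⌉₊).toOuterMeasure
      {x | ¬ ∃ i, ∀ S ∈ 𝓒 n i, ∃ e ∈ S, x e = true} < 1 / 2 := lt_of_le_of_lt le_add_self hn1
  have hlt : (1 : ℝ≥0∞) < 1 / 2 + 1 / 2 := by
    calc (1 : ℝ≥0∞) = _ := hcompl.symm
      _ < 1 / 2 + 1 / 2 := ENNReal.add_lt_add hn2 hR
  rw [ENNReal.add_halves] at hlt
  exact lt_irrefl _ hlt

/-- **No circuit family computing polynomial depth-3 monotone functions strongly detects** (the crux `MonotoneBlind`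
restricted to depth 3, for circuits over ANY basis and of any size, as long as what they compute is, eventually, an
OR of `≤ n^c` monotone CNFs with `≤ n^c` clauses each). [folklore] -/
theorem karlinRubin_not_detects_of_computes_depth3 {δ : ℝ} (hδ : 0 < δ) (hδ' : δ < 1 / 2) (c : ℕ)
    (C : (n : ℕ) → Circuit ((⊤ : SimpleGraph (Fin n)).edgeSet)) (m : ℕ → ℕ)
    (𝓒 : (n : ℕ) → Fin (m n) → Finset (Finset (⊤ : SimpleGraph (Fin n)).edgeSet))
    (hC : ∀ᶠ n : ℕ in atTop, ∀ x, (C n).eval x = true ↔ ∃ i, ∀ S ∈ 𝓒 n i, ∃ e ∈ S, x e = true)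
    (hm : ∀ᶠ n : ℕ in atTop, m n ≤ n ^ c) (h𝓒 : ∀ᶠ n : ℕ in atTop, ∀ i, #(𝓒 n i) ≤ n ^ c) :
    ¬ Tendsto (fun n : ℕ =>
        (erdosRenyiHalf n).toOuterMeasure {x | (C n).eval x = true} +
          (plantedCliqueDist n ⌈(n : ℝ) ^ (1 / 2 - δ)⌉₊).toOuterMeasure {x | (C n).eval x = false})
        atTop (𝓝 0) := by
  intro hT
  refine karlinRubin_monotoneBlind_depth3 hδ hδ' c m 𝓒 hm h𝓒 (hT.congr' ?_)
  filter_upwards [hC] with n hn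
  have h1 : {x : EdgeVec n | (C n).eval x = true} = {x | ∃ i, ∀ S ∈ 𝓒 n i, ∃ e ∈ S, x e = true} := by
    ext x; exact hn x
  have h2 : {x : EdgeVec n | (C n).eval x = false} = {x | ¬ ∃ i, ∀ S ∈ 𝓒 n i, ∃ e ∈ S, x e = true} := by
    ext x
    simp only [Set.mem_setOf_eq, ← hn x, Bool.not_eq_true]
  rw [h1, h2]

/-! ### Registered form -/

/-- **stub_depth3Blind** (registered side result of stmt-PneNP-18027, depth-3 line of seat 0; NOT a stub of the
picked line's composition): `MonotoneBlind` for polynomial ORs of polynomial monotone CNFs (depth 3). [folklore] -/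
theorem stub_depth3Blind : ∀ δ : ℝ, 0 < δ → δ < 1 / 2 → ∀ c : ℕ, ∀ m : ℕ → ℕ, ∀ 𝓒 : (n : ℕ) → Fin (m n) → Finset (Finset ((⊤ : SimpleGraph (Fin n)).edgeSet)), (∀ᶠ n : ℕ in atTop, m n ≤ n ^ c) → (∀ᶠ n : ℕ in atTop, ∀ i, (𝓒 n i).card ≤ n ^ c) → ¬ Tendsto (fun n : ℕ => (erdosRenyiHalf n).toOuterMeasure {x | ∃ i, ∀ S ∈ 𝓒 n i, ∃ e ∈ S, x e = true} + (plantedCliqueDist n ⌈(n : ℝ) ^ (1 / 2 - δ)⌉₊).toOuterMeasure {x | ¬ ∃ i, ∀ S ∈ 𝓒 n i, ∃ e ∈ S, x e = true}) atTop (𝓝 0) :=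
  fun _ hδ hδ' c m 𝓒 hm h𝓒 => karlinRubin_monotoneBlind_depth3 hδ hδ' c m 𝓒 hm h𝓒

end Summit.PneNP.PneNP.Theorems
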